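import Literature.Probability.LatticeModels.WeightedCurrents
import Literature.Probability.LatticeModels.CurrentInsertion
import HarnessLib

/-!
# Clusters of random currents and the decoupling identity across a cluster

Topic `Probability/LatticeModels`, namespace `Literature.Probability.LatticeModels` (dot-notation
extensions in `Literature.Probability.LatticeModels.Current`). Infrastructure for the random-current
proof of the Aizenman–Graham inequality (Tasaki–Hara 2015, App. A §3.6, Lemma A.19 "conditioning on
the connected cluster"; Aizenman–Graham 1983), for a finite graph `G`, currents `Current G`
(`RandomCurrents.lean`), the nested switching lemma of `CurrentSwitching.lean` and the vocabulary of
`WeightedCurrents.lean` (`offGraph G S` = `G` with the edges meeting `S` removed, `Current.cluster`,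
`Current.eweight K`, `Current.spliceOff`):

* currents living on a vertex set: `m` lives inside `B` iff `Current.IsSupp (offGraph G Bᶜ) m`, and
  off `B` iff `Current.IsSupp (offGraph G B) m` (`Current.isSupp_offGraph_iff'`,
  `Current.isSupp_offGraph_compl_iff`);
* `Current.restrictTo W n` — the part of `n` on the edges inside `W` (`= spliceOff Wᶜ 0 n`,
  `Current.restrictTo_eq_spliceOff`; not to be confused with the *graph* restriction
  `Literature.Probability.Percolation.restrictTo` of `SusceptibilityMeanFieldLower.lean`);
* the structural facts behind Lemma A.19: a current splits as `n = n|_{C} + n|_{Cᶜ}` along its own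
  cluster `C = C_n(s)` (no edge carrying current crosses `∂C`), weights multiply, sources split as
  `∂n ∩ C` and `∂n \ C`, clusters and connections are read off the two parts
  (`Current.eq_restrictTo_add_restrictTo_compl`, `Current.eweight_add_of_isSupp`,
  `Current.sources_add_eq_iff_of_isSupp`, `Current.cluster_add_eq_of_isSupp`,
  `Current.reachable_add_iff_right_of_isSupp`);
* **the decoupling identity** `Current.tsum_pair_eq_sum_cluster` (Tasaki–Hara (A.128)–(A.132), in
  `ℝ≥0∞` so that no summability bookkeeping is needed, edge-dependent couplings `K ≥ 0`): for every
  vertex `s` and every `Φ ≥ 0` on pairs of currents,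
  `∑_{(n₁,n₂)} w(n₁)w(n₂) Φ(n₁,n₂) = ∑_B ∑_{(m,k)} 𝟙[m ⊑ B, C_{m₁+m₂}(s) = B] 𝟙[k ⊑ Bᶜ]
      w(m₁)w(m₂)w(k₁)w(k₂) Φ(m₁+k₁, m₂+k₂)`,
  where `m ⊑ B` (resp. `k ⊑ Bᶜ`) means both currents of the pair are supported on `offGraph G Bᶜ`
  (resp. `offGraph G B`).

**Relation to the tree.** The same mechanism exists for currents `ℰ_Λ → ℕ` on the edges of a finite
volume of a locally finite graph (`FieldCurrents.lean`: `crestr` = `restrictTo`,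
`gweight_eq_mul_of_csupp_union` = `eweight_add_of_isSupp`, `tsum_eq_tsum_prod_of_csupp_union` = the
reindexing step, `clusterCompl`/`csupp_cut_of_clusterCompl_eq`/`clusterCompl_eq_iff` = the cluster
facts; `MeanFieldDifferentialInequality.currentPairSum_clusterCompl_eq`). It is redone here for the
`Current G` formalism because the Aizenman–Graham proof consumes, in five different instances, the
*nested* switching lemma with a current supported on a subgraph and the connection event through
that subgraph (`Current.tsum_switching`, `CurrentSwitching.lean`), the parity lemma
`Current.even_reachable_count` (`UrsellFourCurrentsProofs.lean`) and the edge splitting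
`Current.splitAt` (`CurrentInsertion.lean`), all of which live in the `Current G` formalism
(`FieldCurrents.tsum_switching_theta` switches two currents with a *common* support). The dictionary
to the finite-volume state `isingTwoPoint G Λ β 0 .free` of a locally finite graph (the setting of
`aizenmanGraham_inequality`, `AizenmanGrahamInequality.lean`) is the transport
`IsingTransport.isingExpect_free_map` along `↥Λ ↪ V` (the free state in `Λ` is the free state on
`univ` of the finite graph induced on `Λ`) followed by `isingCorr_free_eq_currentSum_div`.

## References

* H. Tasaki, T. Hara, *相転移と臨界現象の数理* (Mathematical theory of phase transitions and critical
  phenomena), Kyoritsu, 2015, Appendix A §3.6, Lemma A.19 and its proof, (A.126)–(A.132)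
  [TasakiHara2015].
* M. Aizenman, R. Graham, *On the renormalized coupling constant and the susceptibility in φ⁴₄
  field theory and the Ising model in four dimensions*, Nucl. Phys. B 225 (1983) 261–288
  [AizenmanGraham1983].
* M. Aizenman, *Geometric analysis of φ⁴ fields and Ising models*, Comm. Math. Phys. 86 (1982) 1–48
  [Aizenman1982].
-/

noncomputable section

open MeasureTheory Finset Filter Topology
open scoped symmDiff ENNReal

namespace Literature.Probability.LatticeModels

variable {V : Type*} [Fintype V] [DecidableEq V] {G : SimpleGraph V} [DecidableRel G.Adj]

namespace Current

/-! ### Currents living on a vertex set -/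

/-- A current is supported on `offGraph G S` iff every edge carrying current avoids `S`
(Tasaki–Hara's `n ∈ 𝓝_{Λ∖S}`). [cite: TasakiHara2015, App. A (A.113)] -/
theorem isSupp_offGraph_iff' (S : Finset V) (n : Current G) :
    IsSupp (offGraph G S) n ↔ ∀ e : G.edgeFinset, n e ≠ 0 → ∀ v ∈ (e : Sym2 V), v ∉ S := by
  rw [isSupp_offGraph_iff]
  constructor
  · intro h e hne v hv hvS
    exact hne (h e fun ho => ho v hv hvS)
  · intro h e he
    by_contra hne
    exact he (h e hne)

/-- A current is supported on `offGraph G Bᶜ` iff it lives inside `B`: every edge carrying current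
has both endpoints in `B` (Tasaki–Hara's `n ∈ 𝓝_B`). [cite: TasakiHara2015, App. A (A.113)] -/
theorem isSupp_offGraph_compl_iff (B : Finset V) (n : Current G) :
    IsSupp (offGraph G Bᶜ) n ↔ ∀ e : G.edgeFinset, n e ≠ 0 → ∀ v ∈ (e : Sym2 V), v ∈ B := by
  rw [isSupp_offGraph_iff']
  simp only [Finset.mem_compl, not_not]

/-- The restriction of a current to the edges inside `W` (Tasaki–Hara (A.129), `n'` and `n''`); it
is `spliceOff Wᶜ 0 n` of `WeightedCurrents.lean` (`restrictTo_eq_spliceOff`). [cite: TasakiHara2015, App. A (A.129)] -/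
def restrictTo (W : Finset V) (n : Current G) : Current G := fun e =>
  if ∀ v ∈ (e : Sym2 V), v ∈ W then n e else 0

/-- Value of the restriction on an edge inside `W`. [folklore] -/
theorem restrictTo_apply_of_forall_mem {W : Finset V} (n : Current G) {e : G.edgeFinset}
    (he : ∀ v ∈ (e : Sym2 V), v ∈ W) : restrictTo W n e = n e := if_pos he

/-- Value of the restriction on an edge not inside `W`. [folklore] -/
theorem restrictTo_apply_of_not {W : Finset V} (n : Current G) {e : G.edgeFinset}
    (he : ¬∀ v ∈ (e : Sym2 V), v ∈ W) : restrictTo W n e = 0 := if_neg he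

/-- The restriction lives inside `W`: it is supported on `offGraph G Wᶜ`. [cite: TasakiHara2015, App. A (A.129)] -/
theorem isSupp_restrictTo (W : Finset V) (n : Current G) : IsSupp (offGraph G Wᶜ) (restrictTo W n) := by
  rw [isSupp_offGraph_compl_iff]
  intro e hne
  by_contra h
  exact hne (restrictTo_apply_of_not n h)

/-- The restriction to a complement lives off `B`: it is supported on `offGraph G B`. [cite: TasakiHara2015, App. A (A.129)] -/
theorem isSupp_offGraph_restrictTo_compl (B : Finset V) (n : Current G) :
    IsSupp (offGraph G B) (restrictTo Bᶜ n) := by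
  have h := isSupp_restrictTo (G := G) Bᶜ n
  rwa [compl_compl] at h

/-- The restriction is the splice of `WeightedCurrents.lean` with the zero current: it keeps `n` on
the edges off `Wᶜ` (i.e. inside `W`) and puts `0` elsewhere. [folklore] -/
theorem restrictTo_eq_spliceOff (W : Finset V) (n : Current G) : restrictTo W n = spliceOff Wᶜ 0 n := by
  funext e
  simp only [restrictTo, spliceOff, EdgeOff, Finset.mem_compl, not_not, Pi.zero_apply]

/-- The restriction is below the current. [folklore] -/
theorem restrictTo_le (W : Finset V) (n : Current G) : restrictTo W n ≤ n := by
  intro e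
  unfold restrictTo
  split_ifs <;> simp

/-- A current living inside `W` is its own restriction to `W`. [folklore] -/
theorem restrictTo_eq_self_of_isSupp {W : Finset V} {n : Current G} (h : IsSupp (offGraph G Wᶜ) n) :
    restrictTo W n = n := by
  funext e
  unfold restrictTo
  split_ifs with he
  · rfl
  · by_contra h0
    exact he ((isSupp_offGraph_compl_iff W n).1 h e (Ne.symm h0))

/-- Restriction is additive. [folklore] -/
theorem restrictTo_add (W : Finset V) (m k : Current G) :
    restrictTo W (m + k) = restrictTo W m + restrictTo W k := by
  funext e
  simp only [restrictTo, Pi.add_apply]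
  split_ifs <;> simp

/-- A current living off `W` has zero restriction to `W` (an edge has an endpoint, which cannot
both lie in `W` and avoid `W`). [folklore] -/
theorem restrictTo_eq_zero_of_isSupp {W : Finset V} {k : Current G} (h : IsSupp (offGraph G W) k) :
    restrictTo W k = 0 := by
  funext e
  unfold restrictTo
  split_ifs with he
  · by_contra h0
    have h' := (isSupp_offGraph_iff' W k).1 h e h0
    obtain ⟨e, hemem⟩ := e
    induction e using Sym2.ind with
    | _ a b => exact h' a (Sym2.mem_mk_left a b) (he a (Sym2.mem_mk_left a b))
  · rfl

/-- A current living inside `W` has zero restriction to `Wᶜ`. [folklore] -/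
theorem restrictTo_compl_eq_zero_of_isSupp {W : Finset V} {m : Current G} (h : IsSupp (offGraph G Wᶜ) m) :
    restrictTo Wᶜ m = 0 :=
  restrictTo_eq_zero_of_isSupp h

/-- Recovering the inside part: `(m + k)|_W = m` for `m` inside `W` and `k` off `W`. [cite: TasakiHara2015, App. A (A.129)–(A.130)] -/
theorem restrictTo_add_of_isSupp {W : Finset V} {m k : Current G} (hm : IsSupp (offGraph G Wᶜ) m)
    (hk : IsSupp (offGraph G W) k) : restrictTo W (m + k) = m := by
  rw [restrictTo_add, restrictTo_eq_self_of_isSupp hm, restrictTo_eq_zero_of_isSupp hk, add_zero]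

/-- Recovering the outside part: `(m + k)|_{Wᶜ} = k` for `m` inside `W` and `k` off `W`. [cite: TasakiHara2015, App. A (A.129)–(A.130)] -/
theorem restrictTo_compl_add_of_isSupp {W : Finset V} {m k : Current G}
    (hm : IsSupp (offGraph G Wᶜ) m) (hk : IsSupp (offGraph G W) k) :
    restrictTo Wᶜ (m + k) = k := by
  have hk' : IsSupp (offGraph G Wᶜᶜ) k := by rwa [compl_compl]
  rw [restrictTo_add, restrictTo_compl_eq_zero_of_isSupp hm, restrictTo_eq_self_of_isSupp hk', zero_add]

/-- On every edge one of `m` (inside `W`) and `k` (off `W`) vanishes. [folklore] -/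
theorem apply_eq_zero_or_of_isSupp {W : Finset V} {m k : Current G} (hm : IsSupp (offGraph G Wᶜ) m)
    (hk : IsSupp (offGraph G W) k) (e : G.edgeFinset) : m e = 0 ∨ k e = 0 := by
  by_contra h
  push Not at h
  have h1 := (isSupp_offGraph_compl_iff W m).1 hm e h.1
  have h2 := (isSupp_offGraph_iff' W k).1 hk e h.2
  obtain ⟨e, hemem⟩ := e
  induction e using Sym2.ind with
  | _ a b => exact h2 a (Sym2.mem_mk_left a b) (h1 a (Sym2.mem_mk_left a b))

/-- **Weights multiply across a vertex cut**: `w_K(m + k) = w_K(m) w_K(k)` when `m ⊑ W` and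
`k ⊑ Wᶜ`, for arbitrary edge couplings `K` (Tasaki–Hara: "もちろん重みも `w(nᵢ) = w(nᵢ') w(nᵢ'')`
と分解できる"). [cite: TasakiHara2015, App. A, proof of Lemma A.19] -/
theorem wweight_add_of_isSupp {W : Finset V} {m k : Current G} (hm : IsSupp (offGraph G Wᶜ) m)
    (hk : IsSupp (offGraph G W) k) (K : G.edgeFinset → ℝ) :
    (m + k).wweight K = m.wweight K * k.wweight K := by
  unfold wweight
  rw [← Finset.prod_mul_distrib]
  refine Finset.prod_congr rfl fun e _ => ?_
  rcases apply_eq_zero_or_of_isSupp hm hk e with h | h <;> simp [h]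

/-- Uniform-coupling case: `w_β(m + k) = w_β(m) w_β(k)` for `m ⊑ W`, `k ⊑ Wᶜ`. [cite: TasakiHara2015, App. A, proof of Lemma A.19] -/
theorem weight_add_of_isSupp {W : Finset V} {m k : Current G} (hm : IsSupp (offGraph G Wᶜ) m)
    (hk : IsSupp (offGraph G W) k) (β : ℝ) : (m + k).weight β = m.weight β * k.weight β :=
  wweight_add_of_isSupp hm hk fun _ => β

/-- The sources of a current living inside `W` lie in `W`. [cite: TasakiHara2015, App. A, proof of Lemma A.19] -/
theorem sources_subset_of_isSupp {W : Finset V} {n : Current G} (h : IsSupp (offGraph G Wᶜ) n) :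
    n.sources ⊆ W := by
  intro x hx
  rw [mem_sources_iff] at hx
  by_contra hxW
  have hdeg : n.degree x = 0 := by
    unfold degree
    refine Finset.sum_eq_zero fun e _ => ?_
    split_ifs with hxe
    · by_contra hne
      exact hxW ((isSupp_offGraph_compl_iff W n).1 h e hne x hxe)
    · rfl
  rw [hdeg] at hx
  exact Nat.not_odd_zero hx

/-- The sources of a current living off `S` avoid `S`. [cite: TasakiHara2015, App. A, proof of Lemma A.19] -/
theorem sources_subset_compl_of_isSupp {S : Finset V} {n : Current G} (h : IsSupp (offGraph G S) n) :
    n.sources ⊆ Sᶜ := by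
  have h' : IsSupp (offGraph G Sᶜᶜ) n := by rwa [compl_compl]
  exact sources_subset_of_isSupp h'

/-- **Sources split across a vertex cut**: for `m` inside `W` and `k` off `W`,
`∂(m + k) = A ↔ ∂m = A ∩ W ∧ ∂k = A \ W`. [cite: TasakiHara2015, App. A, proof of Lemma A.19] -/
theorem sources_add_eq_iff_of_isSupp {W : Finset V} {m k : Current G} (hm : IsSupp (offGraph G Wᶜ) m)
    (hk : IsSupp (offGraph G W) k) (A : Finset V) :
    (m + k).sources = A ↔ m.sources = A ∩ W ∧ k.sources = A \ W := by
  have hmW := sources_subset_of_isSupp hm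
  have hkW := sources_subset_compl_of_isSupp hk
  rw [sources_add]
  constructor
  · intro h
    constructor
    · ext x
      simp only [Finset.mem_inter]
      constructor
      · intro hx
        refine ⟨?_, hmW hx⟩
        rw [← h, Finset.mem_symmDiff]
        exact Or.inl ⟨hx, fun hxk => (Finset.mem_compl.1 (hkW hxk)) (hmW hx)⟩
      · rintro ⟨hxA, hxW⟩
        rw [← h, Finset.mem_symmDiff] at hxA
        rcases hxA with ⟨hxm, _⟩ | ⟨hxk, _⟩
        · exact hxm
        · exact absurd hxW (Finset.mem_compl.1 (hkW hxk))
    · ext x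
      simp only [Finset.mem_sdiff]
      constructor
      · intro hx
        refine ⟨?_, Finset.mem_compl.1 (hkW hx)⟩
        rw [← h, Finset.mem_symmDiff]
        exact Or.inr ⟨hx, fun hxm => (Finset.mem_compl.1 (hkW hx)) (hmW hxm)⟩
      · rintro ⟨hxA, hxW⟩
        rw [← h, Finset.mem_symmDiff] at hxA
        rcases hxA with ⟨hxm, _⟩ | ⟨hxk, _⟩
        · exact absurd (hmW hxm) hxW
        · exact hxk
  · rintro ⟨h1, h2⟩
    rw [h1, h2]
    ext x
    simp only [Finset.mem_symmDiff, Finset.mem_inter, Finset.mem_sdiff]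
    tauto

/-! ### Clusters -/

omit [DecidableEq V] in
/-- The cluster is monotone in the current. [folklore] -/
theorem cluster_mono {n n' : Current G} (h : n ≤ n') (s : V) : n.cluster s ⊆ n'.cluster s := by
  intro v hv
  rw [mem_cluster_iff] at hv ⊢
  exact hv.mono (Percolation.openGraph_mono (traced_mono h))

/-- A traced edge meets a cluster in `0` or `2` endpoints: if `n e > 0` and one endpoint of `e`
is in `C_n(s)` then all are. [cite: TasakiHara2015, App. A, proof of Lemma A.19] -/
theorem forall_mem_cluster_of_pos {n : Current G} {s : V} {e : G.edgeFinset} (he : 0 < n e)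
    {v : V} (hv : v ∈ (e : Sym2 V)) (hvC : v ∈ n.cluster s) : ∀ u ∈ (e : Sym2 V), u ∈ n.cluster s := by
  intro u hu
  obtain ⟨e, hemem⟩ := e
  rw [mem_cluster_iff] at hvC ⊢
  by_cases huv : u = v
  · rw [huv]; exact hvC
  · refine hvC.trans (SimpleGraph.Adj.reachable ?_)
    rw [Percolation.openGraph_adj]
    refine ⟨?_, Ne.symm huv⟩
    have hes : e = s(v, u) := by
      induction e using Sym2.ind with
      | _ a b =>
        rw [Sym2.mem_iff] at hv hu
        rcases hv with rfl | rfl <;> rcases hu with rfl | rfl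
        · exact absurd rfl huv
        · rfl
        · exact Sym2.eq_swap
        · exact absurd rfl huv
    rw [← hes]
    exact ⟨hemem, he⟩

/-- **A current splits along its own cluster**: with `C = C_n(s)`, `n = n|_C + n|_{Cᶜ}` — no edge
carrying current crosses `∂C` (Tasaki–Hara, proof of Lemma A.19: "`b ∉ 𝓑_A` かつ `b ∉ 𝓑_{Λ∖A}`
というボンド `b` については `(nᵢ)_b = 0` となる. よって `nᵢ = nᵢ' + nᵢ''`"). More generally this holds for
every current below one whose cluster is `C`. [cite: TasakiHara2015, App. A, proof of Lemma A.19] -/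
theorem eq_restrictTo_add_restrictTo_compl {n N : Current G} (hle : n ≤ N) (s : V) :
    n = restrictTo (N.cluster s) n + restrictTo (N.cluster s)ᶜ n := by
  funext e
  simp only [Pi.add_apply, restrictTo]
  rcases Nat.eq_zero_or_pos (n e) with h0 | hpos
  · simp [h0]
  · have hposN : 0 < N e := lt_of_lt_of_le hpos (hle e)
    by_cases hin : ∀ v ∈ (e : Sym2 V), v ∈ N.cluster s
    · have hout : ¬∀ v ∈ (e : Sym2 V), v ∈ (N.cluster s)ᶜ := by
        intro h
        obtain ⟨e', he'⟩ := e
        induction e' using Sym2.ind with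
        | _ a b =>
          exact (Finset.mem_compl.1 (h a (Sym2.mem_mk_left a b))) (hin a (Sym2.mem_mk_left a b))
      rw [if_pos hin, if_neg hout, add_zero]
    · have hout : ∀ v ∈ (e : Sym2 V), v ∈ (N.cluster s)ᶜ := by
        intro v hv
        rw [Finset.mem_compl]
        intro hvC
        exact hin (forall_mem_cluster_of_pos hposN hv hvC)
      rw [if_neg hin, if_pos hout, zero_add]

/-- **Connections from the inside**: if `m ⊑ B` and `k ⊑ Bᶜ` then from a vertex of `B` the trace
of `m + k` reaches exactly what the trace of `m` reaches. [cite: TasakiHara2015, App. A, proof of Lemma A.19] -/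
theorem reachable_add_iff_left_of_isSupp {B : Finset V} {m k : Current G}
    (hm : IsSupp (offGraph G Bᶜ) m) (hk : IsSupp (offGraph G B) k) {s : V} (hs : s ∈ B) (v : V) :
    (Percolation.openGraph (m + k).traced).Reachable s v ↔ (Percolation.openGraph m.traced).Reachable s v := by
  constructor
  · -- walks from `s ∈ B` never use an edge of `k` (both endpoints of such an edge are outside `B`)
    suffices key : ∀ (u w : V) (p : (Percolation.openGraph (m + k).traced).Walk u w), u ∈ B →
        (Percolation.openGraph m.traced).Reachable u w ∧ w ∈ B by
      intro h
      obtain ⟨p⟩ := h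
      exact (key s v p hs).1
    intro u w p
    induction p with
    | nil => exact fun hu => ⟨SimpleGraph.Reachable.refl _, hu⟩
    | @cons u x w hux p ih =>
      intro hu
      rw [Percolation.openGraph_adj] at hux
      obtain ⟨⟨hG, hpos⟩, hne⟩ := hux
      simp only [Pi.add_apply] at hpos
      have hk0 : k ⟨s(u, x), hG⟩ = 0 := by
        by_contra hk0
        exact (isSupp_offGraph_iff' B k).1 hk ⟨s(u, x), hG⟩ hk0 u (Sym2.mem_mk_left u x) hu
      rw [hk0, add_zero] at hpos
      have hx : x ∈ B :=
        (isSupp_offGraph_compl_iff B m).1 hm ⟨s(u, x), hG⟩ (Nat.pos_iff_ne_zero.1 hpos) x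
          (Sym2.mem_mk_right u x)
      have hadj : (Percolation.openGraph m.traced).Adj u x := by
        rw [Percolation.openGraph_adj]
        exact ⟨⟨hG, hpos⟩, hne⟩
      obtain ⟨hr, hw⟩ := ih hx
      exact ⟨hadj.reachable.trans hr, hw⟩
  · intro h
    exact h.mono (Percolation.openGraph_mono (traced_mono le_self_add))

/-- **Connections from the outside**: if `m ⊑ B`, `k ⊑ Bᶜ` then from a vertex outside `B` the trace
of `m + k` reaches exactly what the trace of `k` reaches (Tasaki–Hara, proof of (A.147): "`x₄` と `v`
は `C(x₃)` の外で結ばれている"). [cite: TasakiHara2015, App. A, proof of (A.147)] -/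
theorem reachable_add_iff_right_of_isSupp {B : Finset V} {m k : Current G}
    (hm : IsSupp (offGraph G Bᶜ) m) (hk : IsSupp (offGraph G B) k) {x : V} (hx : x ∉ B) (y : V) :
    (Percolation.openGraph (m + k).traced).Reachable x y ↔ (Percolation.openGraph k.traced).Reachable x y := by
  have hk' : IsSupp (offGraph G Bᶜᶜ) k := by rwa [compl_compl]
  have := reachable_add_iff_left_of_isSupp hk' hm (Finset.mem_compl.2 hx) y
  rwa [add_comm] at this

/-- **The cluster of the recombined current**: if `m ⊑ B` with `C_m(s) = B` and `k ⊑ Bᶜ` then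
`C_{m+k}(s) = B`. [cite: TasakiHara2015, App. A, proof of Lemma A.19] -/
theorem cluster_add_eq_of_isSupp {B : Finset V} {m k : Current G} (hm : IsSupp (offGraph G Bᶜ) m)
    (hk : IsSupp (offGraph G B) k) {s : V} (hms : m.cluster s = B) : (m + k).cluster s = B := by
  have hs : s ∈ B := hms ▸ mem_cluster_self m s
  ext v
  rw [mem_cluster_iff, reachable_add_iff_left_of_isSupp hm hk hs, ← mem_cluster_iff, hms]

/-- **The cluster of the inside part**: `C_{n|_C}(s) = C` for `C = C_n(s)`: a walk from `s` stays in
`C`, so all its edges are inside `C`. [cite: TasakiHara2015, App. A, proof of Lemma A.19] -/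
theorem cluster_restrictTo_cluster (n : Current G) (s : V) :
    (restrictTo (n.cluster s) n).cluster s = n.cluster s := by
  refine Finset.Subset.antisymm (cluster_mono (restrictTo_le _ _) s) ?_
  intro v hv
  rw [mem_cluster_iff] at hv ⊢
  -- transfer the walk: every vertex on it is in the cluster, so every edge is inside
  have key := reachable_tracedIn_of_forall_mem (offGraph G (n.cluster s)ᶜ) (n := n) (Λ := n.cluster s)
    (x := s) (y := v) (fun u hu => mem_cluster_iff.2 hu)
    (fun a b ha hb hab => ⟨hab, by simpa using ha, by simpa using hb⟩) hv
  refine key.mono (Percolation.openGraph_mono ?_)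
  rintro e ⟨he1, hG, hpos⟩
  refine ⟨hG, ?_⟩
  have hin : ∀ u ∈ (e : Sym2 V), u ∈ n.cluster s := fun u hu => by
    have := (mem_edgeSet_offGraph.1 he1).2 u hu
    simpa using this
  show 0 < restrictTo (n.cluster s) n ⟨e, hG⟩
  rw [restrictTo_apply_of_forall_mem n hin]
  exact hpos


omit [DecidableEq V] in
/-- Supported currents are closed under addition. [folklore] -/
theorem isSupp_add {G₁ : SimpleGraph V} [DecidableRel G₁.Adj] {m m' : Current G} (hm : IsSupp G₁ m)
    (hm' : IsSupp G₁ m') : IsSupp G₁ (m + m') := fun e he => by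
  simp [Pi.add_apply, hm e he, hm' e he]

omit [DecidableEq V] in
/-- Conversely, a sum of currents is supported on `G₁` only if both summands are. [folklore] -/
theorem isSupp_of_isSupp_add_left {G₁ : SimpleGraph V} [DecidableRel G₁.Adj] {m m' : Current G}
    (h : IsSupp G₁ (m + m')) : IsSupp G₁ m := fun e he => by
  have := h e he
  simp only [Pi.add_apply, Nat.add_eq_zero_iff] at this
  exact this.1

omit [DecidableEq V] in
/-- A sum of currents is supported on `G₁` only if both summands are. [folklore] -/
theorem isSupp_of_isSupp_add_right {G₁ : SimpleGraph V} [DecidableRel G₁.Adj] {m m' : Current G}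
    (h : IsSupp G₁ (m + m')) : IsSupp G₁ m' := fun e he => by
  have := h e he
  simp only [Pi.add_apply, Nat.add_eq_zero_iff] at this
  exact this.2

/-! ### Weights in `ℝ≥0∞` (the tree's `Current.eweight K` of `WeightedCurrents.lean`) -/

/-- **Weights multiply across a vertex cut**, `ℝ≥0∞` form, couplings `K ≥ 0`. [cite: TasakiHara2015, App. A, proof of Lemma A.19] -/
theorem eweight_add_of_isSupp {K : G.edgeFinset → ℝ} (hK : ∀ e, 0 ≤ K e) {W : Finset V} {m k : Current G}
    (hm : IsSupp (offGraph G Wᶜ) m) (hk : IsSupp (offGraph G W) k) :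
    (m + k).eweight K = m.eweight K * k.eweight K := by
  rw [eweight, wweight_add_of_isSupp hm hk, ENNReal.ofReal_mul (wweight_nonneg hK m)]
  rfl

/-! ### The decoupling identity (Tasaki–Hara, Lemma A.19) -/

/-- **Decoupling across the cluster of `s`** (the mechanism of Tasaki–Hara 2015, Lemma A.19,
(A.128)–(A.132): "`n₁, n₂` に関する和を `C_{n₁+n₂}(s)` で条件付けよう"). For `β ≥ 0`, a vertex `s` and
any `Φ ≥ 0` on pairs of currents, the weighted sum over pairs `(n₁, n₂)` equals the sum over the
value `B` of the cluster `C_{n₁+n₂}(s)`, of the sum over inside pairs `m = (m₁, m₂)` supported on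
`offGraph G Bᶜ` (inside `B`) with `C_{m₁+m₂}(s) = B` and outside pairs `k = (k₁, k₂)` supported on
`offGraph G B`, of `w(m₁)w(m₂)w(k₁)w(k₂) Φ(m₁ + k₁, m₂ + k₂)`: the map `(m, k) ↦ m + k` is a
weight-preserving bijection onto the pairs with `C_{n₁+n₂}(s) = B`, because no edge carrying current
crosses the boundary of the cluster. Edge-dependent couplings `K ≥ 0` are allowed. [cite: TasakiHara2015, App. A, Lemma A.19, (A.128)–(A.132)] -/
theorem tsum_pair_eq_sum_cluster {K : G.edgeFinset → ℝ} (hK : ∀ e, 0 ≤ K e) (s : V)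
    (Φ : Current G × Current G → ℝ≥0∞) :
    ∑' p : Current G × Current G, p.1.eweight K * p.2.eweight K * Φ p =
      ∑ B : Finset V, ∑' q : (Current G × Current G) × (Current G × Current G),
        (if IsSupp (offGraph G Bᶜ) q.1.1 ∧ IsSupp (offGraph G Bᶜ) q.1.2 ∧
            (q.1.1 + q.1.2).cluster s = B then eweight K q.1.1 * eweight K q.1.2 else 0) *
        (if IsSupp (offGraph G B) q.2.1 ∧ IsSupp (offGraph G B) q.2.2
            then eweight K q.2.1 * eweight K q.2.2 else 0) *
        Φ (q.1.1 + q.2.1, q.1.2 + q.2.2) := by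
  classical
  -- Step 1: insert `1 = ∑_B 𝟙[C(s) = B]` and exchange the sums
  set f : Finset V → Current G × Current G → ℝ≥0∞ := fun B p =>
    if (p.1 + p.2).cluster s = B then eweight K p.1 * eweight K p.2 * Φ p else 0 with hf_def
  have h1 : ∀ p : Current G × Current G,
      eweight K p.1 * eweight K p.2 * Φ p = ∑ B : Finset V, f B p := by
    intro p
    simp only [hf_def]
    rw [Finset.sum_ite_eq Finset.univ ((p.1 + p.2).cluster s), if_pos (Finset.mem_univ _)]
  simp_rw [h1]
  rw [Summable.tsum_finsetSum (fun B _ => ENNReal.summable)]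
  refine Finset.sum_congr rfl fun B _ => ?_
  -- Step 2: for fixed `B`, reindex by `(m, k) ↦ m + k`
  set g : (Current G × Current G) × (Current G × Current G) → ℝ≥0∞ := fun q =>
    (if IsSupp (offGraph G Bᶜ) q.1.1 ∧ IsSupp (offGraph G Bᶜ) q.1.2 ∧
        (q.1.1 + q.1.2).cluster s = B then eweight K q.1.1 * eweight K q.1.2 else 0) *
    (if IsSupp (offGraph G B) q.2.1 ∧ IsSupp (offGraph G B) q.2.2
        then eweight K q.2.1 * eweight K q.2.2 else 0) *
    Φ (q.1.1 + q.2.1, q.1.2 + q.2.2) with hg_def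
  change ∑' p, f B p = ∑' q, g q
  -- on the support of `g` the side conditions hold
  have hsupp : ∀ q, g q ≠ 0 → (IsSupp (offGraph G Bᶜ) q.1.1 ∧ IsSupp (offGraph G Bᶜ) q.1.2 ∧
      (q.1.1 + q.1.2).cluster s = B) ∧ (IsSupp (offGraph G B) q.2.1 ∧ IsSupp (offGraph G B) q.2.2) := by
    intro q hq
    simp only [hg_def] at hq
    by_cases hin : IsSupp (offGraph G Bᶜ) q.1.1 ∧ IsSupp (offGraph G Bᶜ) q.1.2 ∧
        (q.1.1 + q.1.2).cluster s = B
    · by_cases hout : IsSupp (offGraph G B) q.2.1 ∧ IsSupp (offGraph G B) q.2.2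
      · exact ⟨hin, hout⟩
      · rw [if_neg hout] at hq; simp at hq
    · rw [if_neg hin] at hq; simp at hq
  -- the value of `g` on its support
  have hgval : ∀ q, g q ≠ 0 → g q = eweight K q.1.1 * eweight K q.1.2 *
      (eweight K q.2.1 * eweight K q.2.2) * Φ (q.1.1 + q.2.1, q.1.2 + q.2.2) := by
    intro q hq
    obtain ⟨hin, hout⟩ := hsupp q hq
    simp only [hg_def, if_pos hin, if_pos hout]
  set i : Function.support g → Current G × Current G := fun q =>
    (q.1.1.1 + q.1.2.1, q.1.1.2 + q.1.2.2) with hi_def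
  refine tsum_eq_tsum_of_ne_zero_bij i ?_ ?_ ?_
  · -- injectivity: the parts are recovered as restrictions
    rintro ⟨q, hq⟩ ⟨q', hq'⟩ h
    obtain ⟨⟨hq11, hq12, -⟩, hq21, hq22⟩ := hsupp q hq
    obtain ⟨⟨hq11', hq12', -⟩, hq21', hq22'⟩ := hsupp q' hq'
    simp only [hi_def, Prod.mk.injEq] at h
    obtain ⟨ha, hb⟩ := h
    have e11 : q.1.1 = q'.1.1 := by
      rw [← restrictTo_add_of_isSupp hq11 hq21, ha, restrictTo_add_of_isSupp hq11' hq21']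
    have e21 : q.2.1 = q'.2.1 := by
      rw [← restrictTo_compl_add_of_isSupp hq11 hq21, ha, restrictTo_compl_add_of_isSupp hq11' hq21']
    have e12 : q.1.2 = q'.1.2 := by
      rw [← restrictTo_add_of_isSupp hq12 hq22, hb, restrictTo_add_of_isSupp hq12' hq22']
    have e22 : q.2.2 = q'.2.2 := by
      rw [← restrictTo_compl_add_of_isSupp hq12 hq22, hb, restrictTo_compl_add_of_isSupp hq12' hq22']
    exact Subtype.ext (Prod.ext (Prod.ext e11 e12) (Prod.ext e21 e22))
  · -- the range covers the support of `f B`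
    intro p hp
    rw [Function.mem_support] at hp
    simp only [hf_def] at hp
    by_cases hC : (p.1 + p.2).cluster s = B
    swap
    · rw [if_neg hC] at hp; exact absurd rfl hp
    rw [if_pos hC] at hp
    set N := p.1 + p.2 with hN
    set m₁ := restrictTo B p.1
    set m₂ := restrictTo B p.2
    set k₁ := restrictTo Bᶜ p.1
    set k₂ := restrictTo Bᶜ p.2
    have hm₁ : IsSupp (offGraph G Bᶜ) m₁ := isSupp_restrictTo _ _
    have hm₂ : IsSupp (offGraph G Bᶜ) m₂ := isSupp_restrictTo _ _
    have hk₁ : IsSupp (offGraph G B) k₁ := isSupp_offGraph_restrictTo_compl _ _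
    have hk₂ : IsSupp (offGraph G B) k₂ := isSupp_offGraph_restrictTo_compl _ _
    have hp1 : p.1 = m₁ + k₁ := by
      have := eq_restrictTo_add_restrictTo_compl (le_self_add : p.1 ≤ p.1 + p.2) s
      rwa [hC] at this
    have hp2 : p.2 = m₂ + k₂ := by
      have := eq_restrictTo_add_restrictTo_compl (le_add_self : p.2 ≤ p.1 + p.2) s
      rwa [hC] at this
    have hclm : (m₁ + m₂).cluster s = B := by
      have : m₁ + m₂ = restrictTo B (p.1 + p.2) := (restrictTo_add B p.1 p.2).symm
      rw [this, ← hC, cluster_restrictTo_cluster]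
    set q : (Current G × Current G) × (Current G × Current G) := ((m₁, m₂), (k₁, k₂)) with hq
    have hgq : g q = eweight K p.1 * eweight K p.2 * Φ p :=
      calc g q = eweight K m₁ * eweight K m₂ * (eweight K k₁ * eweight K k₂) * Φ (m₁ + k₁, m₂ + k₂) := by
            simp only [hg_def, hq, if_pos (And.intro hm₁ (And.intro hm₂ hclm)), if_pos (And.intro hk₁ hk₂)]
        _ = eweight K (m₁ + k₁) * eweight K (m₂ + k₂) * Φ (m₁ + k₁, m₂ + k₂) := by
            rw [eweight_add_of_isSupp hK hm₁ hk₁, eweight_add_of_isSupp hK hm₂ hk₂]; ring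
        _ = eweight K p.1 * eweight K p.2 * Φ p := by rw [← hp1, ← hp2, Prod.mk.eta]
    have hgq0 : g q ≠ 0 := by rw [hgq]; exact hp
    refine ⟨⟨q, hgq0⟩, ?_⟩
    simp only [hi_def, hq]
    rw [← hp1, ← hp2]
  · -- values agree
    rintro ⟨q, hq⟩
    obtain ⟨⟨hq11, hq12, hcl⟩, hq21, hq22⟩ := hsupp q hq
    rw [hgval q hq]
    simp only [hi_def, hf_def]
    have hsum : q.1.1 + q.2.1 + (q.1.2 + q.2.2) = (q.1.1 + q.1.2) + (q.2.1 + q.2.2) := by abel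
    have hcl' : (q.1.1 + q.2.1 + (q.1.2 + q.2.2)).cluster s = B := by
      rw [hsum]
      exact cluster_add_eq_of_isSupp (isSupp_add hq11 hq12) (isSupp_add hq21 hq22) hcl
    rw [if_pos hcl', eweight_add_of_isSupp hK hq11 hq21, eweight_add_of_isSupp hK hq12 hq22]
    ring

end Current

end Literature.Probability.LatticeModels
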